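import Literature.RepresentationTheory.Kovacevic2021.SU21UnitarityCriterion
import HarnessLib

/-!
# Necessity of Kovačević's sign conditions: an invariant Hermitian form is diagonal in the basis `u^k_{n,m}`
# and its weights solve the three recursions; `A D' ≤ 0`, `B C' ≤ 0`

Continuation of `Literature.RepresentationTheory.Kovacevic2021.SU21UnitarityCriterion` (sufficiency: weights
solving the `𝔨`-recursion and the two edge recursions give an invariant positive definite Hermitian form).  Here the
converse, for an ARBITRARY datum [Kovacevic2021, §4 proof of Thm 4: "the form is positive iff `a d < 0` and
`b c < 0`"]:

* §0 unitarizability is an isomorphism invariant of the `𝔤𝔩(3,ℂ)`-module (`IsUnitarizable.of_equiv`);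
* §1 an `𝔰𝔲(2,1)`-invariant Hermitian form `B` on `𝒟.V` is DIAGONAL in the basis `u^k_{n,m}` (distinct
  `𝔨`-weights are `B`-orthogonal; equal weights in different `K`-types are separated by the raising operator
  `X_α`, `form_vec_vec_eq_zero`);
* §2 its diagonal values `c(n,m,k) = B(u^k_{n,m}, u^k_{n,m}) > 0` satisfy the `𝔨`-condition and the two edge
  conditions (`exists_weights_of_isUnitarizable`), so that unitarizability is EQUIVALENT to the solvability of
  the three recursions by positive weights (`isUnitarizable_iff_exists_weights`);
* §3 consequently on a unitarizable datum every edge product `A_{n,m} D_{n+1,m+3}` and `B_{n,m} C_{n+1,m-3}`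
  (both end points `K`-types) is a non-positive real number, and `A_{n,m} = 0 ↔ D_{n+1,m+3} = 0`,
  `B_{n,m} = 0 ↔ C_{n+1,m-3} = 0` (`prodAD_of_isUnitarizable`, `prodBC_of_isUnitarizable`).

Theorems only; no named facts.

## References

* D. Kovačević, *Unitary `(𝔤,K)` modules of `SU(2,1)`*, Acta Math. Spalatensia 1 (2021) 105–125
  (arXiv:1810.01752): §4 Thm 4 and its proof. [Kovacevic2021]
* A. Borel, N. Wallach (2000), VI Thm 4.12 p. 133. [BorelWallach2000]
-/

noncomputable section

open Finsupp

namespace Literature.RepresentationTheory.Kovacevic2021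

-- Mathlib idiom (Mathlib/Algebra/Lie/OfAssociative.lean): commutator brackets on associative algebras; needed for
-- the `𝔤𝔩(3,ℂ)`-module structure on `𝒟.V`, as in every file of this directory.
attribute [local instance 100] LieRing.ofAssociativeRing

namespace SU21Datum

/-! ## §0 Unitarizability is an isomorphism invariant -/

/-- **Transport of unitarizability** along an isomorphism of `𝔤𝔩(3,ℂ)`-modules: pull the invariant form back.
[cite: BorelWallach2000, VI Thm 4.12] [cite: Kovacevic2021, §4 Thm 4] -/
theorem IsUnitarizable.of_equiv {𝒟₁ 𝒟₂ : SU21Datum} (e : 𝒟₁.V ≃ₗ⁅ℂ, Matrix (Fin 3) (Fin 3) ℂ⁆ 𝒟₂.V)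
    (h : 𝒟₂.IsUnitarizable) : 𝒟₁.IsUnitarizable := by
  obtain ⟨B, hB1, hB2, hB3⟩ := h
  let f : 𝒟₁.V →ₗ[ℂ] 𝒟₂.V :=
    ((e : 𝒟₁.V →ₗ⁅ℂ, Matrix (Fin 3) (Fin 3) ℂ⁆ 𝒟₂.V) : 𝒟₁.V →ₗ[ℂ] 𝒟₂.V)
  have hmap : ∀ (x : Matrix (Fin 3) (Fin 3) ℂ) (v : 𝒟₁.V), f ⁅x, v⁆ = ⁅x, f v⁆ := fun x v =>
    (e : 𝒟₁.V →ₗ⁅ℂ, Matrix (Fin 3) (Fin 3) ℂ⁆ 𝒟₂.V).map_lie x v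
  have hinj : Function.Injective f := fun a b hab => e.injective hab
  have happ : ∀ v w, (B.comp f).compl₂ f v w = B (f v) (f w) := fun v w => rfl
  refine ⟨(B.comp f).compl₂ f, fun v w => ?_, fun v hv => ?_, fun i j v w => ?_⟩
  · rw [happ, happ]
    exact hB1 (f v) (f w)
  · rw [happ]
    exact hB2 (f v) fun h0 => hv (hinj (by rw [h0, map_zero]))
  · rw [happ, happ, hmap, hmap]
    exact hB3 i j (f v) (f w)

variable {𝒟 : SU21Datum} (B : 𝒟.V →ₗ⋆[ℂ] 𝒟.V →ₗ[ℂ] ℂ)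

/-! ## §1 Invariant Hermitian forms are diagonal in the basis `u^k_{n,m}` -/

/-- `H_α = E₀₀ - E₁₁` is self-adjoint for an invariant form [cite: Kovacevic2021, §4 proof of Thm 4] -/
theorem form_lie_Hα (hB : ∀ (i j : Fin 3) (v w : 𝒟.V), B ⁅E i j, v⁆ w = suSign i * suSign j * B v ⁅E j i, w⁆)
    (v w : 𝒟.V) : B ⁅E 0 0 - E 1 1, v⁆ w = B v ⁅E 0 0 - E 1 1, w⁆ := by
  rw [sub_lie, sub_lie, map_sub, LinearMap.sub_apply, map_sub, hB 0 0, hB 1 1, suSign_zero, suSign_one,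
    one_mul, one_mul, one_mul]

/-- `Z = E₀₀ + E₁₁ - 2E₂₂` is self-adjoint for an invariant form [cite: Kovacevic2021, §4 proof of Thm 4] -/
theorem form_lie_Z (hB : ∀ (i j : Fin 3) (v w : 𝒟.V), B ⁅E i j, v⁆ w = suSign i * suSign j * B v ⁅E j i, w⁆)
    (v w : 𝒟.V) :
    B ⁅E 0 0 + E 1 1 - (2 : ℂ) • E 2 2, v⁆ w = B v ⁅E 0 0 + E 1 1 - (2 : ℂ) • E 2 2, w⁆ := by
  rw [sub_lie, add_lie, smul_lie, sub_lie, add_lie, smul_lie, map_sub, map_add, LinearMap.map_smulₛₗ,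
    LinearMap.sub_apply, LinearMap.add_apply, LinearMap.smul_apply, map_sub, map_add, map_smul, hB 0 0, hB 1 1,
    hB 2 2, suSign_zero, suSign_one, suSign_two, map_ofNat]
  ring

/-- **Distinct `𝔨`-weights are orthogonal**: `B(u^k_{n,m}, u^{k'}_{n',m'}) = 0` unless `m = m'` and
`n - 2k = n' - 2k'`. [cite: Kovacevic2021, §4 proof of Thm 4] -/
theorem form_vec_vec_eq_zero_of_weight
    (hB : ∀ (i j : Fin 3) (v w : 𝒟.V), B ⁅E i j, v⁆ w = suSign i * suSign j * B v ⁅E j i, w⁆)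
    {n m k n' m' k' : ℤ} (h : n - 2 * k ≠ n' - 2 * k' ∨ m ≠ m') : B (𝒟.vec n m k) (𝒟.vec n' m' k') = 0 := by
  rcases h with h | h
  · have e := form_lie_Hα B hB (𝒟.vec n m k) (𝒟.vec n' m' k')
    rw [lie_Hα_vec, lie_Hα_vec, LinearMap.map_smulₛₗ, LinearMap.smul_apply, map_smul, smul_eq_mul, smul_eq_mul,
      map_sub, map_add, map_one, map_mul, map_ofNat, map_intCast, map_intCast] at e
    have hne : ((n : ℂ) + 1 - 2 * k) - ((n' : ℂ) + 1 - 2 * k') ≠ 0 := by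
      have : ((n - 2 * k : ℤ) : ℂ) ≠ ((n' - 2 * k' : ℤ) : ℂ) := fun h' => h (by exact_mod_cast h')
      push_cast at this
      intro h0; apply this; linear_combination h0
    have : (((n : ℂ) + 1 - 2 * k) - ((n' : ℂ) + 1 - 2 * k')) * B (𝒟.vec n m k) (𝒟.vec n' m' k') = 0 := by
      linear_combination e
    exact (mul_eq_zero.1 this).resolve_left hne
  · have e := form_lie_Z B hB (𝒟.vec n m k) (𝒟.vec n' m' k')
    rw [lie_Z_vec, lie_Z_vec, LinearMap.map_smulₛₗ, LinearMap.smul_apply, map_smul, smul_eq_mul, smul_eq_mul,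
      map_intCast] at e
    have hne : (m : ℂ) - m' ≠ 0 := by
      have : (m : ℂ) ≠ (m' : ℂ) := fun h' => h (by exact_mod_cast h')
      exact sub_ne_zero.2 this
    have : ((m : ℂ) - m') * B (𝒟.vec n m k) (𝒟.vec n' m' k') = 0 := by linear_combination e
    exact (mul_eq_zero.1 this).resolve_left hne

/-- **Equal weights in different `K`-types are orthogonal** (raising with `X_α = E₀₁` kills `u^1_{n,m}` first on
the smaller `K`-type): `B(u^{j+1}_{n,m}, u^{k'}_{n',m}) = 0` for `n < n'`, `n - 2(j+1) = n' - 2k'`.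
[cite: Kovacevic2021, §4 proof of Thm 4] -/
theorem form_vec_vec_eq_zero_of_lt
    (hB : ∀ (i j : Fin 3) (v w : 𝒟.V), B ⁅E i j, v⁆ w = suSign i * suSign j * B v ⁅E j i, w⁆)
    {n n' : ℤ} (m : ℤ) (hlt : n < n') :
    ∀ (j : ℕ) (k' : ℤ), n - 2 * ((j : ℤ) + 1) = n' - 2 * k' → B (𝒟.vec n m ((j : ℤ) + 1)) (𝒟.vec n' m k') = 0
  | 0, k', h => by
    have hk' : 1 ≤ k' - 1 := by push_cast at h; omega
    have hv : 𝒟.vec n' m k' = -⁅E 1 0, 𝒟.vec n' m (k' - 1)⁆ := by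
      rw [lie_E10_vec n' m hk', sub_add_cancel, neg_neg]
    have e := hB 0 1 (𝒟.vec n m 1) (𝒟.vec n' m (k' - 1))
    rw [lie_E01_vec_one, map_zero, LinearMap.zero_apply, suSign_zero, suSign_one, one_mul, one_mul] at e
    rw [Nat.cast_zero, zero_add, hv, map_neg, ← e, neg_zero]
  | j + 1, k', h => by
    have ih := form_vec_vec_eq_zero_of_lt hB m hlt j (k' - 1) (by push_cast at h ⊢; omega)
    have hv : 𝒟.vec n m (((j + 1 : ℕ) : ℤ) + 1) = -⁅E 1 0, 𝒟.vec n m ((j : ℤ) + 1)⁆ := by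
      rw [lie_E10_vec n m (by omega), neg_neg]
      push_cast
      rfl
    have e := hB 1 0 (𝒟.vec n m ((j : ℤ) + 1)) (𝒟.vec n' m k')
    rw [suSign_zero, suSign_one, one_mul, one_mul, lie_E01_vec, map_smul, ih, smul_zero] at e
    rw [hv, map_neg, LinearMap.neg_apply, e, neg_zero]

/-- **An invariant Hermitian form is diagonal in the basis `u^k_{n,m}`.** [cite: Kovacevic2021, §4 proof of Thm 4] -/
theorem form_vec_vec_eq_zero (hB1 : ∀ v w, B v w = starRingEnd ℂ (B w v))
    (hB : ∀ (i j : Fin 3) (v w : 𝒟.V), B ⁅E i j, v⁆ w = suSign i * suSign j * B v ⁅E j i, w⁆)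
    {n m k n' m' k' : ℤ} (hne : (n, m, k) ≠ (n', m', k')) : B (𝒟.vec n m k) (𝒟.vec n' m' k') = 0 := by
  by_cases hw : n - 2 * k = n' - 2 * k' ∧ m = m'
  swap
  · exact form_vec_vec_eq_zero_of_weight B hB (not_and_or.1 hw)
  obtain ⟨hw, rfl⟩ := hw
  have hnn : n ≠ n' := by
    rintro rfl
    exact hne (by rw [show k = k' by omega])
  rcases lt_or_gt_of_ne hnn with hlt | hgt
  · by_cases hk : 1 ≤ k
    · obtain ⟨j, hj⟩ : ∃ j : ℕ, k = (j : ℤ) + 1 := ⟨(k - 1).toNat, by omega⟩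
      subst hj
      exact form_vec_vec_eq_zero_of_lt B hB m hlt j k' hw
    · rw [vec_of_lt_one n m (by omega), map_zero, LinearMap.zero_apply]
  · by_cases hk : 1 ≤ k'
    · obtain ⟨j, hj⟩ : ∃ j : ℕ, k' = (j : ℤ) + 1 := ⟨(k' - 1).toNat, by omega⟩
      subst hj
      rw [hB1, form_vec_vec_eq_zero_of_lt B hB m hgt j k hw.symm, map_zero]
    · rw [vec_of_lt_one n' m (by omega), map_zero]

/-! ## §2 The weights of an invariant form solve the three recursions -/

/-- **Necessity of the three recursions.** The diagonal values `c(n,m,k) = B(u^k_{n,m}, u^k_{n,m})` of an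
invariant positive definite Hermitian form are positive on the admissible labels and satisfy the `𝔨`-condition
`c(n,m,k+1) = k(n-k)c(n,m,k)`, the `A`–`D` edge condition `(n+1-k) conj(A_{n,m}) c(n+1,m+3,k) = -D_{n+1,m+3} c(n,m,k)`
and the `B`–`C` edge condition `conj(C_{n,m}) c(n-1,m+3,k) = -(n-k) B_{n-1,m+3} c(n,m,k)`.
[cite: Kovacevic2021, §4 proof of Thm 4] -/
theorem exists_weights_of_isUnitarizable (𝒟 : SU21Datum) (h : IsUnitarizable 𝒟) :
    ∃ c : ℤ → ℤ → ℤ → ℝ,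
      (∀ n m k, (n, m) ∈ 𝒟.S → 1 ≤ k → k ≤ n → 0 < c n m k) ∧
      (∀ n m k, (n, m) ∈ 𝒟.S → 1 ≤ k → k < n → c n m (k + 1) = k * (n - k) * c n m k) ∧
      (∀ n m k, (n, m) ∈ 𝒟.S → (n + 1, m + 3) ∈ 𝒟.S → 1 ≤ k → k ≤ n →
        ((n : ℂ) + 1 - k) * starRingEnd ℂ (𝒟.A n m) * c (n + 1) (m + 3) k = -𝒟.D (n + 1) (m + 3) * c n m k) ∧
      (∀ n m k, (n, m) ∈ 𝒟.S → (n - 1, m + 3) ∈ 𝒟.S → 1 ≤ k → k ≤ n - 1 →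
        starRingEnd ℂ (𝒟.C n m) * c (n - 1) (m + 3) k = -(((n : ℂ) - k) * 𝒟.B (n - 1) (m + 3)) * c n m k) := by
  obtain ⟨B, hB1, hB2, hB3⟩ := h
  -- the diagonal values are real
  have hre : ∀ n m k : ℤ, (((B (𝒟.vec n m k) (𝒟.vec n m k)).re : ℝ) : ℂ) = B (𝒟.vec n m k) (𝒟.vec n m k) :=
    fun n m k => Complex.conj_eq_iff_re.1 (hB1 _ _).symm
  have hdiag : ∀ {n m k n' m' k' : ℤ}, (n, m, k) ≠ (n', m', k') → B (𝒟.vec n m k) (𝒟.vec n' m' k') = 0 :=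
    fun hne => form_vec_vec_eq_zero B hB1 hB3 hne
  refine ⟨fun n m k => (B (𝒟.vec n m k) (𝒟.vec n m k)).re, ?_, ?_, ?_, ?_⟩
  · intro n m k hS hk hkn
    exact hB2 _ (vec_ne_zero ⟨hS, hk, hkn⟩)
  · -- the `𝔨`-condition from `E₀₁ ↦ X_α`, `E₁₀ ↦ Y_α`
    intro n m k hS hk hkn
    have e := hB3 0 1 (𝒟.vec n m (k + 1)) (𝒟.vec n m k)
    rw [lie_E01_vec, lie_E10_vec n m hk, add_sub_cancel_right, LinearMap.map_smulₛₗ, LinearMap.smul_apply,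
      map_neg (B _), smul_eq_mul, suSign_zero, suSign_one, one_mul, one_mul, map_neg, map_mul, map_sub, map_sub,
      map_add, map_one, map_intCast, map_intCast] at e
    have e' : (((B (𝒟.vec n m (k + 1)) (𝒟.vec n m (k + 1))).re : ℝ) : ℂ)
        = (k : ℂ) * ((n : ℂ) - k) * (((B (𝒟.vec n m k) (𝒟.vec n m k)).re : ℝ) : ℂ) := by
      rw [hre, hre]
      push_cast at e
      linear_combination e
    exact_mod_cast e'
  · -- the `A`–`D` edge from `E₀₂ ↦ X_{α+β}`, `E₂₀ ↦ Y_{α+β}`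
    intro n m k hS hS' hk hkn
    have e := hB3 0 2 (𝒟.vec n m k) (𝒟.vec (n + 1) (m + 3) k)
    rw [lie_E02_vec, lie_E20_vec (n + 1) (m + 3) hk] at e
    simp only [add_sub_cancel_right, map_add, map_smul, LinearMap.map_smulₛₗ, LinearMap.add_apply,
      LinearMap.smul_apply, smul_eq_mul, suSign_zero, suSign_two, map_mul, map_sub, map_add, map_one,
      map_intCast] at e
    have h1 : B (𝒟.vec (n - 1) (m + 3) (k - 1)) (𝒟.vec (n + 1) (m + 3) k) = 0 :=
      hdiag (by simp only [ne_eq, Prod.mk.injEq]; omega)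
    have h2 : B (𝒟.vec n m k) (𝒟.vec (n + 1 + 1) m (k + 1)) = 0 :=
      hdiag (by simp only [ne_eq, Prod.mk.injEq]; omega)
    rw [hre, hre]
    linear_combination e - (((k : ℂ) - 1) * starRingEnd ℂ (𝒟.C n m)) * h1 - 𝒟.B (n + 1) (m + 3) * h2
  · -- the `B`–`C` edge from `E₁₂ ↦ X_β`, `E₂₁ ↦ Y_β`
    intro n m k hS hS' hk hkn
    have e := hB3 1 2 (𝒟.vec n m k) (𝒟.vec (n - 1) (m + 3) k)
    rw [lie_E12_vec n m hk, lie_E21_vec] at e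
    simp only [sub_add_cancel, add_sub_cancel_right, map_add, map_smul, map_neg, LinearMap.map_smulₛₗ,
      LinearMap.add_apply, LinearMap.smul_apply, smul_eq_mul, suSign_one, suSign_two] at e
    have h1 : B (𝒟.vec (n + 1) (m + 3) (k + 1)) (𝒟.vec (n - 1) (m + 3) k) = 0 :=
      hdiag (by simp only [ne_eq, Prod.mk.injEq]; omega)
    have h2 : B (𝒟.vec n m k) (𝒟.vec (n - 1 - 1) m (k - 1)) = 0 :=
      hdiag (by simp only [ne_eq, Prod.mk.injEq]; omega)
    rw [hre, hre]
    push_cast at e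
    linear_combination e + starRingEnd ℂ (𝒟.A n m) * h1 + (((k : ℂ) - 1) * 𝒟.D (n - 1) (m + 3)) * h2

/-- **Kovačević's Theorem 4, mechanism, as an equivalence**: a datum is unitarizable iff positive weights on the
admissible labels solve the `𝔨`-recursion and the two edge recursions. [cite: Kovacevic2021, §4 Thm 4 (proof)] -/
theorem isUnitarizable_iff_exists_weights (𝒟 : SU21Datum) :
    IsUnitarizable 𝒟 ↔ ∃ c : ℤ → ℤ → ℤ → ℝ,
      (∀ n m k, (n, m) ∈ 𝒟.S → 1 ≤ k → k ≤ n → 0 < c n m k) ∧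
      (∀ n m k, (n, m) ∈ 𝒟.S → 1 ≤ k → k < n → c n m (k + 1) = k * (n - k) * c n m k) ∧
      (∀ n m k, (n, m) ∈ 𝒟.S → (n + 1, m + 3) ∈ 𝒟.S → 1 ≤ k → k ≤ n →
        ((n : ℂ) + 1 - k) * starRingEnd ℂ (𝒟.A n m) * c (n + 1) (m + 3) k = -𝒟.D (n + 1) (m + 3) * c n m k) ∧
      (∀ n m k, (n, m) ∈ 𝒟.S → (n - 1, m + 3) ∈ 𝒟.S → 1 ≤ k → k ≤ n - 1 →
        starRingEnd ℂ (𝒟.C n m) * c (n - 1) (m + 3) k = -(((n : ℂ) - k) * 𝒟.B (n - 1) (m + 3)) * c n m k) :=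
  ⟨exists_weights_of_isUnitarizable 𝒟, fun ⟨c, h1, h2, h3, h4⟩ => isUnitarizable_of_weights 𝒟 c h1 h2 h3 h4⟩

/-! ## §3 The sign conditions `A D' ≤ 0`, `B C' ≤ 0` -/

/-- **`a d < 0`**: on a unitarizable datum, along every edge `(n,m) → (n+1,m+3)` of `K`-types the invariant
product `A_{n,m} D_{n+1,m+3}` is a non-positive real number, and `A_{n,m} = 0 ↔ D_{n+1,m+3} = 0`.
[cite: Kovacevic2021, §4 Thm 4 (proof)] -/
theorem prodAD_of_isUnitarizable (𝒟 : SU21Datum) (h : IsUnitarizable 𝒟) {n m : ℤ} (hS : (n, m) ∈ 𝒟.S)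
    (hS' : (n + 1, m + 3) ∈ 𝒟.S) :
    (𝒟.A n m * 𝒟.D (n + 1) (m + 3)).im = 0 ∧ (𝒟.A n m * 𝒟.D (n + 1) (m + 3)).re ≤ 0 ∧
      (𝒟.A n m = 0 ↔ 𝒟.D (n + 1) (m + 3) = 0) := by
  obtain ⟨c, hpos, -, hAD, -⟩ := exists_weights_of_isUnitarizable 𝒟 h
  have hn : 1 ≤ n := 𝒟.one_le_of_mem hS
  have hc : 0 < c n m 1 := hpos n m 1 hS le_rfl hn
  have hc' : 0 < c (n + 1) (m + 3) 1 := hpos (n + 1) (m + 3) 1 hS' le_rfl (by omega)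
  have e := hAD n m 1 hS hS' le_rfl hn
  push_cast at e
  rw [add_sub_cancel_right] at e
  -- `A D' c = -n |A|² c'`, so `A D'` is the real number `-n |A|² c' / c ≤ 0`
  have hmc : ((‖𝒟.A n m‖ : ℂ)) ^ 2 = starRingEnd ℂ (𝒟.A n m) * 𝒟.A n m := (Complex.conj_mul' _).symm
  have key' : 𝒟.A n m * 𝒟.D (n + 1) (m + 3) * (c n m 1 : ℂ)
      = ((-(n * ‖𝒟.A n m‖ ^ 2 * c (n + 1) (m + 3) 1) : ℝ) : ℂ) := by
    push_cast
    rw [hmc]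
    linear_combination 𝒟.A n m * e
  have key : 𝒟.A n m * 𝒟.D (n + 1) (m + 3)
      = ((-(n * ‖𝒟.A n m‖ ^ 2 * c (n + 1) (m + 3) 1) / c n m 1 : ℝ) : ℂ) := by
    have hc0 : (c n m 1 : ℂ) ≠ 0 := by exact_mod_cast hc.ne'
    rw [Complex.ofReal_div, eq_div_iff hc0, key']
  refine ⟨by rw [key, Complex.ofReal_im], ?_, ?_⟩
  · rw [key, Complex.ofReal_re]
    have : (0 : ℝ) ≤ n := by exact_mod_cast (show (0 : ℤ) ≤ n by omega)
    exact div_nonpos_of_nonpos_of_nonneg (neg_nonpos.2 (by positivity)) hc.le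
  · constructor
    · intro hA
      rw [hA, map_zero, mul_zero, zero_mul] at e
      have hc0 : (c n m 1 : ℂ) ≠ 0 := by exact_mod_cast hc.ne'
      have := mul_eq_zero.1 e.symm
      simpa [hc0] using this
    · intro hD
      rw [hD, neg_zero, zero_mul] at e
      have hc0 : (c (n + 1) (m + 3) 1 : ℂ) ≠ 0 := by exact_mod_cast hc'.ne'
      have hn0 : (n : ℂ) ≠ 0 := by exact_mod_cast (show n ≠ 0 by omega)
      have := mul_eq_zero.1 e
      simp only [mul_eq_zero, hn0, hc0, or_false, false_or, map_eq_zero] at this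
      exact this

/-- **`b c < 0`**: on a unitarizable datum, along every edge `(n,m) → (n+1,m-3)` of `K`-types the invariant
product `B_{n,m} C_{n+1,m-3}` is a non-positive real number, and `B_{n,m} = 0 ↔ C_{n+1,m-3} = 0`.
[cite: Kovacevic2021, §4 Thm 4 (proof)] -/
theorem prodBC_of_isUnitarizable (𝒟 : SU21Datum) (h : IsUnitarizable 𝒟) {n m : ℤ} (hS : (n, m) ∈ 𝒟.S)
    (hS' : (n + 1, m - 3) ∈ 𝒟.S) :
    (𝒟.B n m * 𝒟.C (n + 1) (m - 3)).im = 0 ∧ (𝒟.B n m * 𝒟.C (n + 1) (m - 3)).re ≤ 0 ∧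
      (𝒟.B n m = 0 ↔ 𝒟.C (n + 1) (m - 3) = 0) := by
  obtain ⟨c, hpos, -, -, hBC⟩ := exists_weights_of_isUnitarizable 𝒟 h
  have hn : 1 ≤ n := 𝒟.one_le_of_mem hS
  have hc : 0 < c n m 1 := hpos n m 1 hS le_rfl hn
  have hc' : 0 < c (n + 1) (m - 3) 1 := hpos (n + 1) (m - 3) 1 hS' le_rfl (by omega)
  have e := hBC (n + 1) (m - 3) 1 hS' (by rw [add_sub_cancel_right, sub_add_cancel]; exact hS) le_rfl
    (by omega)
  rw [add_sub_cancel_right, sub_add_cancel] at e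
  push_cast at e
  -- `n B C' c' = -|C'|² c`, so `B C'` is the real number `-|C'|² c / (n c') ≤ 0`
  have hmc : ((‖𝒟.C (n + 1) (m - 3)‖ : ℂ)) ^ 2 = starRingEnd ℂ (𝒟.C (n + 1) (m - 3)) * 𝒟.C (n + 1) (m - 3) :=
    (Complex.conj_mul' _).symm
  have key' : 𝒟.B n m * 𝒟.C (n + 1) (m - 3) * ((n * c (n + 1) (m - 3) 1 : ℝ) : ℂ)
      = ((-(‖𝒟.C (n + 1) (m - 3)‖ ^ 2 * c n m 1) : ℝ) : ℂ) := by
    push_cast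
    rw [hmc]
    linear_combination 𝒟.C (n + 1) (m - 3) * e
  have hpos' : 0 < (n : ℝ) * c (n + 1) (m - 3) 1 := by
    have : (0 : ℝ) < n := by exact_mod_cast (show (0 : ℤ) < n by omega)
    positivity
  have key : 𝒟.B n m * 𝒟.C (n + 1) (m - 3)
      = ((-(‖𝒟.C (n + 1) (m - 3)‖ ^ 2 * c n m 1) / (n * c (n + 1) (m - 3) 1) : ℝ) : ℂ) := by
    have hc0 : ((n * c (n + 1) (m - 3) 1 : ℝ) : ℂ) ≠ 0 := by exact_mod_cast hpos'.ne'
    rw [Complex.ofReal_div, eq_div_iff hc0, key']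
  refine ⟨by rw [key, Complex.ofReal_im], ?_, ?_⟩
  · rw [key, Complex.ofReal_re]
    exact div_nonpos_of_nonpos_of_nonneg (neg_nonpos.2 (by positivity)) hpos'.le
  · constructor
    · intro hB0
      rw [hB0, mul_zero, neg_zero, zero_mul] at e
      have hc0 : (c n m 1 : ℂ) ≠ 0 := by exact_mod_cast hc.ne'
      have := mul_eq_zero.1 e
      simpa [hc0] using this
    · intro hC
      rw [hC, map_zero, zero_mul] at e
      have hc0 : (c (n + 1) (m - 3) 1 : ℂ) ≠ 0 := by exact_mod_cast hc'.ne'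
      have hn0 : (n : ℂ) + 1 - 1 ≠ 0 := by rw [add_sub_cancel_right]; exact_mod_cast (show n ≠ 0 by omega)
      have := mul_eq_zero.1 e.symm
      simp only [mul_eq_zero, neg_eq_zero, hn0, hc0, or_false, false_or] at this
      exact this

end SU21Datum

end Literature.RepresentationTheory.Kovacevic2021
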